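import Mathlib
import HarnessLib

/-!
# The limit `d / (d!)^{1/d} → e`

`Literature/Analysis/SpecialFunctions/FactorialRootLimit.lean`. Everything here is PROVED (no
definition, no named fact): the classical consequence of Stirling's formula

  `lim_{d → ∞} d / (d!)^{1/d} = e`,

in the form in which it enters the proof of the arithmetic holonomy bound of F. Calegari,
V. Dimitrov, Y. Tang, *The unbounded denominators conjecture* (J. Amer. Math. Soc. **38** (2025),
627–702; arXiv:2109.09040), §2.2 (end of the proof of Lemma 2.0.4 of the published numbering):
the Dirichlet exponent of the auxiliary construction (Lemma 2.1.1) produces the factor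
`(d/(d!)^{1/d}) (1 + 1/κ)^{1/d}` in the dimension bound, and "Lemma 2.0.4 now follows by firstly
letting `d → ∞` and then `κ → 0`, and observing that in that limit
`(d/(d!)^{1/d}) (1 + 1/κ)^{1/d} → e` … by Stirling's asymptotic" — this is where Euler's number `e`
in the statement `m ≤ e · ∫_𝕋 log⁺|p ∘ φ| μ_Haar / log|φ'(0)|` of their Theorem 2.0.1 comes from.

* `log_factorial_le` — the upper Stirling bound `log d! ≤ d log d − d + ½ log d + 1` (`d ≥ 1`),
  from the monotonicity of Mathlib's `Stirling.stirlingSeq`; the lower bound is Mathlib's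
  `Stirling.le_log_factorial_stirling`.
* `tendsto_log_sub_log_factorial_div` — `log d − (log d!)/d → 1`.
* `tendsto_div_factorial_rpow` — `d / (d!)^{1/d} → e`.
* `tendsto_div_factorial_rpow_mul_rpow` — CDT's form: for fixed `c > 0` (there `c = 1 + 1/κ`),
  `(d / (d!)^{1/d}) · c^{1/d} → e`.

## References

* [CalegariDimitrovTang2025] F. Calegari, V. Dimitrov, Y. Tang, The unbounded denominators
  conjecture, J. Amer. Math. Soc. 38 (2025), no. 3, 627–702, §2.2 (proof of Lemma 2.0.4, last
  display); arXiv:2109.09040.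
-/

noncomputable section

open Real Filter Topology Nat

namespace Literature.Analysis.SpecialFunctions

/-- **Upper Stirling bound.** For `d ≥ 1`: `log d! ≤ d log d − d + ½ log d + 1` (i.e.
`d! ≤ e √d (d/e)^d`), from `stirlingSeq d ≤ stirlingSeq 1 = e/√2` (Mathlib:
`Stirling.stirlingSeq` is antitone from `1` on). [folklore] -/
theorem log_factorial_le {d : ℕ} (hd : d ≠ 0) :
    Real.log (d ! : ℝ) ≤ d * Real.log d - d + Real.log d / 2 + 1 := by
  obtain ⟨k, rfl⟩ := Nat.exists_eq_succ_of_ne_zero hd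
  have hmono : Stirling.stirlingSeq (k + 1) ≤ Stirling.stirlingSeq 1 := by
    have := Stirling.stirlingSeq'_antitone (Nat.zero_le k)
    simpa using this
  have hpos : 0 < Stirling.stirlingSeq (k + 1) := Stirling.stirlingSeq'_pos k
  have hlog : Real.log (Stirling.stirlingSeq (k + 1)) ≤ Real.log (Stirling.stirlingSeq 1) :=
    Real.log_le_log hpos hmono
  rw [Stirling.stirlingSeq_one, Stirling.log_stirlingSeq_formula,
    Real.log_div (Real.exp_pos 1).ne' (by positivity), Real.log_exp,
    Real.log_sqrt zero_le_two] at hlog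
  have hk : (0 : ℝ) < (k + 1 : ℕ) := by positivity
  rw [Real.log_mul two_ne_zero hk.ne', Real.log_div hk.ne' (Real.exp_pos 1).ne', Real.log_exp] at hlog
  set n : ℝ := ((k + 1 : ℕ) : ℝ) with hn
  -- hlog : log (k+1)! - 1/2 (log 2 + log n) - n (log n - 1) ≤ 1 - log 2 / 2
  linarith

/-- `log d − (log d!)/d → 1` as `d → ∞` (two-sided Stirling bounds and `log d / d → 0`).
[folklore] -/
theorem tendsto_log_sub_log_factorial_div :
    Tendsto (fun d : ℕ ↦ Real.log d - Real.log (d ! : ℝ) / d) atTop (𝓝 1) := by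
  -- `log d / d → 0` along the naturals
  have hlog : Tendsto (fun d : ℕ ↦ Real.log d / d) atTop (𝓝 0) := by
    have h := Real.tendsto_pow_log_div_mul_add_atTop 1 0 1 one_ne_zero
    simp only [pow_one, one_mul, add_zero] at h
    exact h.comp tendsto_natCast_atTop_atTop
  have hinv : Tendsto (fun d : ℕ ↦ (d : ℝ)⁻¹) atTop (𝓝 0) :=
    tendsto_inv_atTop_zero.comp tendsto_natCast_atTop_atTop
  -- lower bound `1 − (log d / 2 + 1)/d`, upper bound `1 − (log d / 2 + log (2π)/2)/d`
  have hlow : Tendsto (fun d : ℕ ↦ 1 - (Real.log d / d / 2 + (d : ℝ)⁻¹)) atTop (𝓝 1) := by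
    have : Tendsto (fun d : ℕ ↦ 1 - (Real.log d / d / 2 + (d : ℝ)⁻¹)) atTop
        (𝓝 (1 - (0 / 2 + 0))) :=
      tendsto_const_nhds.sub ((hlog.div_const 2).add hinv)
    simpa using this
  have hup : Tendsto (fun d : ℕ ↦ 1 - (Real.log d / d / 2 + Real.log (2 * π) / 2 * (d : ℝ)⁻¹))
      atTop (𝓝 1) := by
    have : Tendsto (fun d : ℕ ↦ 1 - (Real.log d / d / 2 + Real.log (2 * π) / 2 * (d : ℝ)⁻¹))
        atTop (𝓝 (1 - (0 / 2 + Real.log (2 * π) / 2 * 0))) :=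
      tendsto_const_nhds.sub ((hlog.div_const 2).add (hinv.const_mul _))
    simpa using this
  refine tendsto_of_tendsto_of_tendsto_of_le_of_le' hlow hup ?_ ?_
  · filter_upwards [eventually_ne_atTop 0] with d hd
    have hdpos : (0 : ℝ) < d := by positivity
    have h := log_factorial_le hd
    have hdiv : Real.log (d ! : ℝ) / d ≤ Real.log d - 1 + Real.log d / d / 2 + (d : ℝ)⁻¹ := by
      rw [div_le_iff₀ hdpos]
      have : (Real.log d - 1 + Real.log d / d / 2 + (d : ℝ)⁻¹) * d =
          d * Real.log d - d + Real.log d / 2 + 1 := by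
        field_simp
      rw [this]
      exact h
    linarith
  · filter_upwards [eventually_ne_atTop 0] with d hd
    have hdpos : (0 : ℝ) < d := by positivity
    have h := Stirling.le_log_factorial_stirling hd
    have hdiv : Real.log d - 1 + Real.log d / d / 2 + Real.log (2 * π) / 2 * (d : ℝ)⁻¹ ≤
        Real.log (d ! : ℝ) / d := by
      rw [le_div_iff₀ hdpos]
      have : (Real.log d - 1 + Real.log d / d / 2 + Real.log (2 * π) / 2 * (d : ℝ)⁻¹) * d =
          d * Real.log d - d + Real.log d / 2 + Real.log (2 * π) / 2 := by
        field_simp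
      rw [this]
      exact h
    linarith

/-- **`d / (d!)^{1/d} → e`** (Stirling). [folklore] -/
theorem tendsto_div_factorial_rpow :
    Tendsto (fun d : ℕ ↦ (d : ℝ) / (d ! : ℝ) ^ ((d : ℝ)⁻¹)) atTop (𝓝 (Real.exp 1)) := by
  have h := (Real.continuous_exp.tendsto 1).comp tendsto_log_sub_log_factorial_div
  refine h.congr' ?_
  filter_upwards [eventually_ne_atTop 0] with d hd
  have hdpos : (0 : ℝ) < d := by positivity
  have hfpos : (0 : ℝ) < (d ! : ℝ) := by positivity
  simp only [Function.comp_apply]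
  rw [Real.exp_sub, Real.exp_log hdpos, Real.rpow_def_of_pos hfpos, div_eq_mul_inv (Real.log _)]

/-- **CDT's form of the Stirling limit** [cite: CalegariDimitrovTang2025, §2.2, proof of
Lemma 2.0.4]: for a fixed `c > 0` (there `c = 1 + 1/κ`),
`(d / (d!)^{1/d}) · c^{1/d} → e` as `d → ∞`. -/
theorem tendsto_div_factorial_rpow_mul_rpow {c : ℝ} (hc : 0 < c) :
    Tendsto (fun d : ℕ ↦ (d : ℝ) / (d ! : ℝ) ^ ((d : ℝ)⁻¹) * c ^ ((d : ℝ)⁻¹)) atTop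
      (𝓝 (Real.exp 1)) := by
  have hinv : Tendsto (fun d : ℕ ↦ (d : ℝ)⁻¹) atTop (𝓝 0) :=
    tendsto_inv_atTop_zero.comp tendsto_natCast_atTop_atTop
  have hc1 : Tendsto (fun d : ℕ ↦ c ^ ((d : ℝ)⁻¹)) atTop (𝓝 1) := by
    have := tendsto_const_nhds.rpow hinv (Or.inl hc.ne')
    simpa [Real.rpow_zero] using this
  simpa using tendsto_div_factorial_rpow.mul hc1

end Literature.Analysis.SpecialFunctions
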